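import Summits.ValiantsHypothesis.ValiantsHypothesis.Theses.ValuativeGCT
import Summits.ValiantsHypothesis.ValiantsHypothesis.Theorems.CutBites.Negative.NonVacuity

/-!
# `ValuativeGCT.CutBites` (stmt-ValiantsHypothesis-12626), line adjugate-pfaffian-kernel — Stub 3 `stub_detStab_transpose`

The `End`-stabiliser of the generic determinant `det_m` (variables `MatIdx m`, action `linSubst`) is
closed under transpose, proved WITHOUT Frobenius' normal form (second half of the contragredient
lemma).  Hypotheses: `hM : linSubst M det_m = det_m` (i.e. `det (T_M G) = det G` for the generic matrix
`G`, `(T_M G)_{ab} = Σ_l M l (a,b) • X_l`), `hU : IsUnit M`, and the cofactor chain rule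
`hC : T*_M (cof (T_M G)) = cof G` (`cof Y = adjugateᵀ Y`, `(T*_M C)_{ab} = Σ_l M (a,b) l • C_l`).
Conclusion: `linSubst Mᵀ det_m = det_m`, i.e. `det (T*_M Z) = det Z` identically.

Proof.  Put `q := linSubst Mᵀ det_m - det_m` and, for a matrix `Z`, let `ψ_Z` be the evaluation
`X_l ↦ Z_l`; then `ψ_Z q = det (T*_M Z) - det Z`.  (A) At `Z₀ = cof (T_M G)`: by `hC`,
`det (T*_M Z₀) = det (cof G) = det G ^ (m-1)` and `det Z₀ = det (T_M G) ^ (m-1) = det G ^ (m-1)` by `hM`,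
so `ψ_{Z₀} q = 0`.  (B) `ψ_{Z₀} = linSubst M ∘ ψ_{cof G}` and `linSubst M` is injective (`M` a unit), so
`ψ_{cof G} q = 0`.  (C) `ψ_{cof G} ∘ ψ_{cof G} = (X_l ↦ det G ^ (m-2) * X_l)` (`cof (cof G) = det G ^ (m-2) • G`,
`m ≠ 1`), and `q` is a form of degree `m`, so `det G ^ ((m-2) m) * q = ψ_{cof G} (ψ_{cof G} q) = 0` in the
domain `ℂ[G]`; `det G ≠ 0` gives `q = 0`.  For `m = 1`, `Mᵀ = M`.  Used by Stub 4 (invariance of the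
witness under the whole abstract stabiliser).  The unfolding / evaluation helpers are stated over any
field `k`. [folklore]
-/

namespace Summit.ValiantsHypothesis.ValiantsHypothesis.Theorems.CutBitesAdjugate

open Literature.NumberTheory.DiophantineGeometry Literature.Computability.AlgebraicComplexity
open MvPolynomial
open scoped BigOperators Matrix

-- `Summit.ValiantsHypothesis.ValiantsHypothesis.…` is the tree's mandated single-conjunct layout (Sub = Summit).
set_option linter.dupNamespace false

/-! ### Unfoldings of `detFormLex` and of `linSubst` on it (any field `k`) -/

/-- Over any field `k`, `det_m` is the determinant of the generic matrix `G = (X (toLex (a, b)))_{ab}`.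
[folklore] -/
theorem cbAdjTr_detFormLex_eq_det (k : Type*) [Field k] (m : ℕ) :
    detFormLex k m
      = (Matrix.of fun a b : Fin m => (X (toLex (a, b)) : MvPolynomial (MatIdx m) k)).det := by
  rw [detFormLex, detPoly, AlgHom.map_det]
  congr 1
  ext a b
  simp [Matrix.mvPolynomialX, rename_X]

/-- Evaluating `det_m` at the entries of a matrix `Z` gives `det Z`. [folklore] -/
theorem cbAdjTr_aeval_detFormLex {k : Type*} [Field k] {S : Type*} [CommRing S] [Algebra k S] (m : ℕ)
    (Z : Matrix (Fin m) (Fin m) S) :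
    MvPolynomial.aeval (R := k) (fun l : MatIdx m => Z (ofLex l).1 (ofLex l).2) (detFormLex k m)
      = Z.det := by
  rw [cbAdjTr_detFormLex_eq_det, AlgHom.map_det]
  congr 1
  ext a b
  simp only [AlgHom.mapMatrix_apply, Matrix.map_apply, Matrix.of_apply, aeval_X]
  rfl

/-- Evaluating `linSubst N det_m` at the entries of a matrix `Z` gives the determinant of the matrix
`(Σ_l N l (a,b) • Z_l)_{ab}` (`= T_N Z`). [folklore] -/
theorem cbAdjTr_aeval_linSubst_detFormLex {k : Type*} [Field k] {S : Type*} [CommRing S] [Algebra k S]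
    (m : ℕ) (N : Matrix (MatIdx m) (MatIdx m) k) (Z : Matrix (Fin m) (Fin m) S) :
    MvPolynomial.aeval (R := k) (fun l : MatIdx m => Z (ofLex l).1 (ofLex l).2)
        (linSubst (MatIdx m) k N (detFormLex k m))
      = (Matrix.of fun a b : Fin m =>
          ∑ l : MatIdx m, N l (toLex (a, b)) • Z (ofLex l).1 (ofLex l).2).det := by
  rw [cbAdjTr_detFormLex_eq_det, AlgHom.map_det, AlgHom.map_det]
  congr 1
  ext a b
  simp only [AlgHom.mapMatrix_apply, Matrix.map_apply, Matrix.of_apply, linSubst_X, map_sum,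
    map_smul, aeval_X]

/-- Evaluating `linSubst Mᵀ det_m` at the entries of a matrix `Z` gives the determinant of
`T*_M Z = (Σ_l M (a,b) l • Z_l)_{ab}`. [folklore] -/
theorem cbAdjTr_aeval_linSubst_transpose_detFormLex {k : Type*} [Field k] {S : Type*} [CommRing S]
    [Algebra k S] (m : ℕ) (M : Matrix (MatIdx m) (MatIdx m) k) (Z : Matrix (Fin m) (Fin m) S) :
    MvPolynomial.aeval (R := k) (fun l : MatIdx m => Z (ofLex l).1 (ofLex l).2)
        (linSubst (MatIdx m) k Mᵀ (detFormLex k m))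
      = (Matrix.of fun a b : Fin m =>
          ∑ l : MatIdx m, M (toLex (a, b)) l • Z (ofLex l).1 (ofLex l).2).det := by
  rw [cbAdjTr_aeval_linSubst_detFormLex]
  rfl

/-- `linSubst M` maps the generic matrix to `T_M G = (Σ_l M l (a,b) • X_l)_{ab}`. [folklore] -/
theorem cbAdjTr_linSubst_mapMatrix_genMat {k : Type*} [CommRing k] (m : ℕ)
    (M : Matrix (MatIdx m) (MatIdx m) k) :
    (linSubst (MatIdx m) k M).mapMatrix
        (Matrix.of fun a b : Fin m => (X (toLex (a, b)) : MvPolynomial (MatIdx m) k))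
      = Matrix.of fun a b : Fin m =>
          ∑ l : MatIdx m, M l (toLex (a, b)) • (X l : MvPolynomial (MatIdx m) k) := by
  ext a b
  simp only [AlgHom.mapMatrix_apply, Matrix.map_apply, Matrix.of_apply, linSubst_X]

/-- `linSubst M det_m = det (T_M G)`. [folklore] -/
theorem cbAdjTr_linSubst_detFormLex {k : Type*} [Field k] (m : ℕ) (M : Matrix (MatIdx m) (MatIdx m) k) :
    linSubst (MatIdx m) k M (detFormLex k m)
      = (Matrix.of fun a b : Fin m =>
          ∑ l : MatIdx m, M l (toLex (a, b)) • (X l : MvPolynomial (MatIdx m) k)).det := by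
  rw [cbAdjTr_detFormLex_eq_det, AlgHom.map_det, cbAdjTr_linSubst_mapMatrix_genMat]

/-! ### Two general facts: `linSubst` by a unit is injective; dilation of a form -/

/-- For a unit `A`, the substitution `linSubst A` is injective (it has the left inverse
`linSubst B`, `B * A = 1`). [folklore] -/
theorem cbAdjTr_linSubst_injective {σ k : Type*} [Fintype σ] [DecidableEq σ] [CommRing k]
    {A : Matrix σ σ k} (hA : IsUnit A) : Function.Injective (linSubst σ k A) := by
  obtain ⟨B, hB⟩ := hA.exists_left_inv
  intro x y hxy
  have h := congrArg (linSubst σ k B) hxy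
  rwa [← AlgHom.comp_apply, ← AlgHom.comp_apply, ← linSubst_mul, hB, linSubst_one,
    AlgHom.id_apply, AlgHom.id_apply] at h

/-- Dilation of a form: substituting `X_i ↦ c * X_i` (`c` any polynomial) in a form `φ` of degree `d`
multiplies it by `c ^ d`. [folklore] -/
theorem cbAdjTr_aeval_mul_X_of_isHomogeneous {σ k : Type*} [CommSemiring k] {φ : MvPolynomial σ k}
    {d : ℕ} (hφ : φ.IsHomogeneous d) (c : MvPolynomial σ k) :
    MvPolynomial.aeval (R := k) (fun i => c * (X i : MvPolynomial σ k)) φ = c ^ d * φ := by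
  conv_lhs => rw [φ.as_sum]
  conv_rhs => rw [φ.as_sum]
  rw [map_sum, Finset.mul_sum]
  refine Finset.sum_congr rfl fun e he => ?_
  have hdeg : (∑ i ∈ e.support, e i) = d := by
    have := hφ (mem_support_iff.mp he)
    simpa [Finsupp.weight_apply, Finsupp.sum] using this
  rw [aeval_monomial, MvPolynomial.algebraMap_eq, Finsupp.prod]
  simp only [mul_pow, Finset.prod_mul_distrib, Finset.prod_pow_eq_pow_sum, hdeg]
  rw [monomial_eq, Finsupp.prod]
  ring

/-! ### The cofactor evaluation `ψ_{cof G}` squares to a dilation -/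

/-- With `Φ := (X_l ↦ (cof G)_l)`, `Φ ∘ Φ = (X_l ↦ det G ^ (m-2) * X_l)` for `m ≠ 1`: indeed
`Φ (Φ X_l) = (cof (cof G))_l` and `adjugate (adjugate G) = det G ^ (m-2) • G`. [folklore] -/
theorem cbAdjTr_aeval_cof_comp_aeval_cof (k : Type*) [CommRing k] (m : ℕ) (hm : m ≠ 1) :
    (MvPolynomial.aeval (R := k) (fun l : MatIdx m =>
        (Matrix.of fun a b : Fin m => (X (toLex (a, b)) : MvPolynomial (MatIdx m) k)).adjugateᵀ
          (ofLex l).1 (ofLex l).2)).comp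
      (MvPolynomial.aeval (R := k) (fun l : MatIdx m =>
        (Matrix.of fun a b : Fin m => (X (toLex (a, b)) : MvPolynomial (MatIdx m) k)).adjugateᵀ
          (ofLex l).1 (ofLex l).2))
    = MvPolynomial.aeval (R := k) (fun l : MatIdx m =>
        (Matrix.of fun a b : Fin m => (X (toLex (a, b)) : MvPolynomial (MatIdx m) k)).det ^ (m - 2) *
          (X l : MvPolynomial (MatIdx m) k)) := by
  set G : Matrix (Fin m) (Fin m) (MvPolynomial (MatIdx m) k) :=
    Matrix.of fun a b : Fin m => (X (toLex (a, b)) : MvPolynomial (MatIdx m) k) with hG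
  set Φ : MvPolynomial (MatIdx m) k →ₐ[k] MvPolynomial (MatIdx m) k :=
    MvPolynomial.aeval (R := k) (fun l : MatIdx m => G.adjugateᵀ (ofLex l).1 (ofLex l).2) with hΦ
  have hΦG : Φ.mapMatrix G = G.adjugateᵀ := by
    ext a b
    simp only [AlgHom.mapMatrix_apply, Matrix.map_apply, hΦ, hG, Matrix.of_apply, aeval_X]
    rfl
  refine MvPolynomial.algHom_ext fun i => ?_
  rw [AlgHom.comp_apply, aeval_X, aeval_X]
  have h1 : Φ (G.adjugateᵀ (ofLex i).1 (ofLex i).2)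
      = (Φ.mapMatrix G.adjugate)ᵀ (ofLex i).1 (ofLex i).2 := by
    simp only [AlgHom.mapMatrix_apply, Matrix.transpose_apply, Matrix.map_apply]
  rw [h1, AlgHom.map_adjugate, hΦG, ← Matrix.adjugate_transpose, Matrix.transpose_transpose,
    Matrix.adjugate_adjugate _ (by rw [Fintype.card_fin]; exact hm), Fintype.card_fin,
    Matrix.smul_apply, smul_eq_mul, hG, Matrix.of_apply]
  rfl

/-! ### The stub -/

/-- **Stub 3 — the stabiliser of `det_m` is closed under transpose, without Frobenius** (contragredient
lemma, second half): from `linSubst M det_m = det_m`, `IsUnit M` and the cofactor chain rule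
`T*_M (cof (T_M G)) = cof G`, also `linSubst Mᵀ det_m = det_m`.  See the module docstring for the
three-step proof (evaluate `q = linSubst Mᵀ det_m - det_m` at `cof (T_M G)`, pull back along the
injective `linSubst M`, square the cofactor evaluation to a dilation and cancel `det G ^ (m(m-2))` in the
domain `ℂ[G]`); `m = 1` is the trivial case `Mᵀ = M`. [folklore] -/
theorem stub_detStab_transpose (m : ℕ) (M : Matrix (MatIdx m) (MatIdx m) ℂ)
    (hM : linSubst (MatIdx m) ℂ M (detFormLex ℂ m) = detFormLex ℂ m) (hU : IsUnit M)
    (hC : (Matrix.of fun a b : Fin m => ∑ l : MatIdx m, M (toLex (a, b)) l •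
        (Matrix.of fun a' b' : Fin m => ∑ l' : MatIdx m, M l' (toLex (a', b')) •
          (X l' : MvPolynomial (MatIdx m) ℂ)).adjugateᵀ (ofLex l).1 (ofLex l).2)
      = (Matrix.of fun a b : Fin m => (X (toLex (a, b)) : MvPolynomial (MatIdx m) ℂ)).adjugateᵀ) :
    linSubst (MatIdx m) ℂ Mᵀ (detFormLex ℂ m) = detFormLex ℂ m := by
  rcases eq_or_ne m 1 with rfl | hm1
  · -- `MatIdx 1` is a singleton, so `Mᵀ = M`
    have hT : Mᵀ = M := Matrix.ext fun i j => by
      have hij : i = j := ofLex.injective (Subsingleton.elim (ofLex i) (ofLex j))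
      rw [Matrix.transpose_apply, hij]
    rw [hT]
    exact hM
  -- notation: the generic matrix `G`, its image `TM = T_M G`, and `q`
  set G : Matrix (Fin m) (Fin m) (MvPolynomial (MatIdx m) ℂ) :=
    Matrix.of fun a b : Fin m => (X (toLex (a, b)) : MvPolynomial (MatIdx m) ℂ) with hG
  set TM : Matrix (Fin m) (Fin m) (MvPolynomial (MatIdx m) ℂ) :=
    Matrix.of fun a' b' : Fin m => ∑ l' : MatIdx m, M l' (toLex (a', b')) •
      (X l' : MvPolynomial (MatIdx m) ℂ) with hTM
  rw [← sub_eq_zero]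
  set q : MvPolynomial (MatIdx m) ℂ :=
    linSubst (MatIdx m) ℂ Mᵀ (detFormLex ℂ m) - detFormLex ℂ m with hq
  have hGdet : G.det = detFormLex ℂ m := (cbAdjTr_detFormLex_eq_det ℂ m).symm
  have hTMdet : TM.det = detFormLex ℂ m := by
    rw [← cbAdjTr_linSubst_detFormLex m M, hM]
  -- (A) `q` vanishes at `Z₀ = cof (T_M G)`
  have hA : MvPolynomial.aeval (R := ℂ)
      (fun l : MatIdx m => TM.adjugateᵀ (ofLex l).1 (ofLex l).2) q = 0 := by
    rw [hq, map_sub, cbAdjTr_aeval_linSubst_transpose_detFormLex, cbAdjTr_aeval_detFormLex]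
    have hC' : (Matrix.of fun a b : Fin m => ∑ l : MatIdx m,
        M (toLex (a, b)) l • TM.adjugateᵀ (ofLex l).1 (ofLex l).2) = G.adjugateᵀ := hC
    rw [hC', Matrix.det_transpose, Matrix.det_transpose, Matrix.det_adjugate, Matrix.det_adjugate,
      hGdet, hTMdet, sub_self]
  -- (B) pull back along the injective `linSubst M`: `q` vanishes at `cof G`
  have hΨ : (MvPolynomial.aeval (R := ℂ)
        (fun l : MatIdx m => TM.adjugateᵀ (ofLex l).1 (ofLex l).2) :
          MvPolynomial (MatIdx m) ℂ →ₐ[ℂ] MvPolynomial (MatIdx m) ℂ)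
      = (linSubst (MatIdx m) ℂ M).comp (MvPolynomial.aeval (R := ℂ)
          (fun l : MatIdx m => G.adjugateᵀ (ofLex l).1 (ofLex l).2)) := by
    refine MvPolynomial.algHom_ext fun i => ?_
    rw [aeval_X, AlgHom.comp_apply, aeval_X]
    have hTM' : TM = (linSubst (MatIdx m) ℂ M).mapMatrix G :=
      (cbAdjTr_linSubst_mapMatrix_genMat m M).symm
    rw [hTM', ← AlgHom.map_adjugate]
    simp only [AlgHom.mapMatrix_apply, Matrix.transpose_apply, Matrix.map_apply]
  have hB : MvPolynomial.aeval (R := ℂ)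
      (fun l : MatIdx m => G.adjugateᵀ (ofLex l).1 (ofLex l).2) q = 0 := by
    apply cbAdjTr_linSubst_injective hU
    rw [map_zero, ← AlgHom.comp_apply, ← hΨ, hA]
  -- (C) square the cofactor evaluation: `det G ^ ((m-2) m) * q = 0` in the domain `ℂ[G]`
  have hhom : q.IsHomogeneous m :=
    (linSubst_isHomogeneous Mᵀ (detFormLex_isHomogeneous ℂ m)).sub (detFormLex_isHomogeneous ℂ m)
  have hCq : (G.det ^ (m - 2)) ^ m * q = 0 := by
    rw [← cbAdjTr_aeval_mul_X_of_isHomogeneous hhom, ← cbAdjTr_aeval_cof_comp_aeval_cof ℂ m hm1,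
      AlgHom.comp_apply, hB, map_zero]
  have hGne : G.det ≠ 0 := by
    rw [hGdet]
    exact Theorems.CutBites.Negative.detFormLex_ne_zero' m
  exact (mul_eq_zero.mp hCq).resolve_left (pow_ne_zero _ (pow_ne_zero _ hGne))

end Summit.ValiantsHypothesis.ValiantsHypothesis.Theorems.CutBitesAdjugate
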